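import Literature.AlgebraicGeometry.Frobenioids.AngularFrobenioidsRelative
import Literature.AlgebraicGeometry.Frobenioids.ArchimedeanBaseComparison
import HarnessLib

/-!
# Frobenioids II, Example 3.3 (ii)–(v) and Remark 3.3.1: the printed claims (named statements)

Mochizuki, *The geometry of Frobenioids II: poly-Frobenioids*, Kyushu J. Math. **62** (2008)
401–460, §3, Example 3.3 (ii)–(v) pp. 28–29 and Remark 3.3.1 p. 29
[cite: MochizukiFrdII2008, Ex 3.3 (ii)-(v) pp.28-29].

Every printed claim of Example 3.3 (ii)–(v) and of Remark 3.3.1 about the categories `C`, `A`, `N`,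
`R` over a base `π : D → D₀` (file `AngularFrobenioidsRelative.lean`) is typed here as a NAMED
STATEMENT `def … : Prop` in found's [FrdI] Def. 1.2/1.3 vocabulary (`PreFrobenioid.IsIsotropic`,
`IsCoAngular`, `IsLinear`, `IsFrobeniusTrivial`, `IsFrobeniusAmple`, `IsMetricallyTrivial`,
`IsFrobeniusIsotropic`, `IsFrobenioid`, `IsBaseIso`), the §0 vocabulary (`IsFSMI`, `IsOfFSMType`,
`IsTotallyEpimorphic`, `CFP`) and abc-iut-L1-t4's Def. 3.1 (v) vocabulary (`RC.IsRCConnected`) reached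
through the comparison functor `ArchFrd.D0.toArchBase`. Statements typed, NOT discharged (the text:
"a routine verification reveals …"); the two cheap ones already PROVED elsewhere are "`A` is of
group-like type" (`ArchFrd.A.isOfType_isGroupLikeObj`) and "all real objects of `N₀` are isomorphic"
(`ArchFrd.N0.nonempty_iso_of_isRealObj`). "Induces an injection on underlying angular regions"
(Rmk. 3.3.1) is rendered as injectivity of `a ↦ c · a^d` on `A_L` (the map on angular data underlying
the isomorphism (c) of Ex. 3.3 (i)).
-/

namespace Literature.AlgebraicGeometry.Frobenioids

open CategoryTheory Opposite
open scoped Pointwise NNReal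

noncomputable section

namespace ArchFrd

universe v u

variable {D : Type u} [Category.{v} D] (π : D ⥤ D0)

/-! ### Example 3.3 (ii), p. 28 -/

/-- **Ex. 3.3 (ii)**: "By Lemma 3.2, (i), it follows immediately that an object of `C` is isotropic [in
the sense of [Mzk5], Definition 1.2, (iv)] if and only if it is naively isotropic".
[cite: MochizukiFrdII2008, Ex 3.3 (ii) p.28] -/
def Ex33ii_isotropic_iff : Prop :=
  ∀ X : C π, PreFrobenioid.IsIsotropic (C.toElem π) X ↔ X.fst.IsNaivelyIsotropic

/-- **Ex. 3.3 (ii)**: "… and that a morphism of `C` is co-angular [in the sense of [Mzk5], Definition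
1.2, (iii)] if and only if it is naively co-angular". [cite: MochizukiFrdII2008, Ex 3.3 (ii) p.28] -/
def Ex33ii_coAngular_iff : Prop :=
  ∀ ⦃X Y : C π⦄ (φ : X ⟶ Y), PreFrobenioid.IsCoAngular (C.toElem π) φ ↔ C0.IsNaivelyCoAngular φ.fst

/-- **Ex. 3.3 (ii)**: "by Lemma 3.2, (iv), every endomorphism of a non-isotropic object of `C` is linear
and co-angular". [cite: MochizukiFrdII2008, Ex 3.3 (ii) p.28] -/
def Ex33ii_endo_of_not_isotropic : Prop :=
  ∀ (X : C π) (φ : X ⟶ X), ¬ PreFrobenioid.IsIsotropic (C.toElem π) X →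
    PreFrobenioid.IsLinear (C.toElem π) φ ∧ PreFrobenioid.IsCoAngular (C.toElem π) φ

/-- **Ex. 3.3 (ii)**: "every endomorphism of an isotropic object of `C` is co-angular".
[cite: MochizukiFrdII2008, Ex 3.3 (ii) p.28] -/
def Ex33ii_endo_of_isotropic : Prop :=
  ∀ (X : C π) (φ : X ⟶ X), PreFrobenioid.IsIsotropic (C.toElem π) X →
    PreFrobenioid.IsCoAngular (C.toElem π) φ

/-- **Ex. 3.3 (ii)**: "the following conditions on an object of `C` are equivalent: (a) the object is
isotropic; (b) the object is Frobenius-trivial" … [cite: MochizukiFrdII2008, Ex 3.3 (ii) p.28] -/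
def Ex33ii_isotropic_iff_frobeniusTrivial : Prop :=
  ∀ X : C π, PreFrobenioid.IsIsotropic (C.toElem π) X ↔ PreFrobenioid.IsFrobeniusTrivial (C.toElem π) X

/-- **Ex. 3.3 (ii)**: … "(b) the object is Frobenius-trivial; (c) the object is Frobenius-ample" are
equivalent. [cite: MochizukiFrdII2008, Ex 3.3 (ii) p.28] -/
def Ex33ii_frobeniusTrivial_iff_frobeniusAmple : Prop :=
  ∀ X : C π, PreFrobenioid.IsFrobeniusTrivial (C.toElem π) X ↔
    PreFrobenioid.IsFrobeniusAmple (C.toElem π) X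

/-- **Ex. 3.3 (ii)**: "we observe that every object of `C` is metrically trivial".
[cite: MochizukiFrdII2008, Ex 3.3 (ii) p.28] -/
def Ex33ii_metricallyTrivial : Prop :=
  PreFrobenioid.IsOfType (PreFrobenioid.IsMetricallyTrivial (C.toElem π))

/-- **Ex. 3.3 (ii)** (HARD, deep pool): "Now a routine verification reveals that `C` satisfies the
conditions of [Mzk5], Definition 1.3, hence that `C` is a *Frobenioid*" (for `D` connected and totally
epimorphic). [cite: MochizukiFrdII2008, Ex 3.3 (ii) p.28] -/
def Ex33ii_isFrobenioid : Prop :=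
  IsGraphConnected D → IsTotallyEpimorphic D → PreFrobenioid.IsFrobenioid (C.toElem π)

/-- **Ex. 3.3 (ii)**: "by Lemma 3.2, (v), it follows that `C` is of Frobenius-isotropic type" [so it
makes sense to speak of the perfection `C^pf`, cf. `ArchFrd.archFrobenioid`].
[cite: MochizukiFrdII2008, Ex 3.3 (ii) p.28] -/
def Ex33ii_frobeniusIsotropic : Prop :=
  PreFrobenioid.IsOfType (PreFrobenioid.IsFrobeniusIsotropic (C.toElem π))

/-! ### Example 3.3 (iii), pp. 28–29 -/

/-- **Ex. 3.3 (iii)**: "we have a natural equivalence of categories `A ⥲ A₀ ×_{D₀} D`".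
[cite: MochizukiFrdII2008, Ex 3.3 (iii) p.29] -/
def Ex33iii_A_equiv : Prop := Nonempty (A π ≌ CFP A0.toD0 π)

/-- **Ex. 3.3 (iii)** `A ≃ A₀ ×_{D₀} D` — PROVED (`A.equivCFP`). [cite: MochizukiFrdII2008, Ex 3.3 (iii) p.29] -/
theorem Ex33iii_A_equiv_holds : Ex33iii_A_equiv π := ⟨A.equivCFP π⟩

/-- **Ex. 3.3 (iii)** (HARD, deep pool): "a routine verification reveals that `A` satisfies the conditions
of [Mzk5], Definition 1.3, hence that `A` is a Frobenioid over the base category `D`" [of group-like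
type: `A.isOfType_isGroupLikeObj`]. [cite: MochizukiFrdII2008, Ex 3.3 (iii) p.29] -/
def Ex33iii_isFrobenioid : Prop :=
  IsGraphConnected D → IsTotallyEpimorphic D → PreFrobenioid.IsFrobenioid (A.toElem π)

/-- **Ex. 3.3 (iii)**: "the isotropic objects of `A` are precisely the isotropic objects of `C`".
[cite: MochizukiFrdII2008, Ex 3.3 (iii) p.29] -/
def Ex33iii_isotropic_iff : Prop :=
  ∀ X : A π, PreFrobenioid.IsIsotropic (A.toElem π) X ↔ PreFrobenioid.IsIsotropic (C.toElem π) X.obj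

/-- **Ex. 3.3 (iii)**: "the co-angular morphisms of `A` are precisely the co-angular isometries of `C`".
[cite: MochizukiFrdII2008, Ex 3.3 (iii) p.29] -/
def Ex33iii_coAngular_iff : Prop :=
  ∀ ⦃X Y : A π⦄ (φ : X ⟶ Y),
    PreFrobenioid.IsCoAngular (A.toElem π) φ ↔ PreFrobenioid.IsCoAngular (C.toElem π) φ.1

/-- **Ex. 3.3 (iii)**: "there is a natural equivalence of categories `N ⥲ N₀ ×_{D₀} D`".
[cite: MochizukiFrdII2008, Ex 3.3 (iii) p.29] -/
def Ex33iii_N_equiv : Prop := Nonempty (N π ≌ CFP N0.toD0 π)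

/-- **Ex. 3.3 (iii)** `N ≃ N₀ ×_{D₀} D` — PROVED (`N.equivCFP`). [cite: MochizukiFrdII2008, Ex 3.3 (iii) p.29] -/
theorem Ex33iii_N_equiv_holds : Ex33iii_N_equiv π := ⟨N.equivCFP π⟩

/-- **Ex. 3.3 (iii)** "`A` … is, in fact, of group-like type" — PROVED (`A.isOfType_isGroupLikeObj`),
recorded next to the statements for the census. [cite: MochizukiFrdII2008, Ex 3.3 (iii) p.29] -/
theorem Ex33iii_groupLike_holds :
    PreFrobenioid.IsOfType (PreFrobenioid.IsGroupLikeObj (A.toElem π)) :=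
  A.isOfType_isGroupLikeObj π

/-! ### Example 3.3 (iv), p. 29 -/

/-- **Ex. 3.3 (iv)**: "If `D` is RC-connected, then `C^Λ`, `A`, `N`, `R` are RC-connected [hence, in
particular, connected]" — RC-connectedness in abc-iut-L1-t4's sense (`RC.IsRCConnected`, Def. 3.1 (v))
through the comparison functor `D0.toArchBase`. Typed for `C = C^ℤ`, `A`, `N`, `R`; for `Λ ∈ {ℚ, ℝ}`
the clause concerns the perfection / realification of `C`, which are interface data tonight
(`LambdaCompletion`; TODO-merge abc-iut-L1-t3 / L1-t5) and is therefore not asserted here of arbitrary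
such data. [cite: MochizukiFrdII2008, Ex 3.3 (iv) p.29] -/
def Ex33iv_rcConnected : Prop :=
  RC.IsRCConnected (π ⋙ D0.toArchBase) →
    RC.IsRCConnected (C.toBase π ⋙ π ⋙ D0.toArchBase) ∧
    RC.IsRCConnected (A.toBase π ⋙ π ⋙ D0.toArchBase) ∧
    RC.IsRCConnected (N.toBase π ⋙ π ⋙ D0.toArchBase) ∧
    RC.IsRCConnected (R.toBase π ⋙ π ⋙ D0.toArchBase)

/-- **Ex. 3.3 (iv)**: "If `D` is RC-connected, then `C^Λ`, `A`, `N`, `R` are … totally epimorphic"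
(`D` totally epimorphic being the standing hypothesis of Ex. 3.3 (i)); typed for `C = C^ℤ`, `A`, `N`,
`R` (see `Ex33iv_rcConnected` for `Λ ≥ ℚ`). [cite: MochizukiFrdII2008, Ex 3.3 (iv) p.29] -/
def Ex33iv_totallyEpimorphic : Prop :=
  IsTotallyEpimorphic D → RC.IsRCConnected (π ⋙ D0.toArchBase) →
    IsTotallyEpimorphic (C π) ∧ IsTotallyEpimorphic (A π) ∧ IsTotallyEpimorphic (N π) ∧
      IsTotallyEpimorphic (R π)

/-- A wide subcategory of a totally epimorphic category is totally epimorphic.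
[cite: MochizukiFrdI2008, §0 p.15] -/
theorem isTotallyEpimorphic_wideSubcategory {E : Type*} [Category E] (P : MorphismProperty E)
    [P.IsMultiplicative] (hE : IsTotallyEpimorphic E) : IsTotallyEpimorphic (WideSubcategory P) := by
  refine ⟨fun {X Y} f => ⟨fun {Z} g h e => ?_⟩⟩
  haveI := hE.epi f.hom
  exact WideSubcategory.hom_ext _ ((cancel_epi f.hom).mp (congrArg InducedWideCategory.Hom.hom e))

/-- A slice `E_A` of a totally epimorphic category is totally epimorphic.
[cite: MochizukiFrdI2008, §0 p.15] -/
theorem isTotallyEpimorphic_over {E : Type*} [Category E] (hE : IsTotallyEpimorphic E) (A : E) :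
    IsTotallyEpimorphic (Over A) := by
  refine ⟨fun {X Y} f => ⟨fun {Z} g h e => ?_⟩⟩
  haveI := hE.epi f.left
  exact Over.OverMorphism.ext ((cancel_epi f.left).mp (congrArg CommaMorphism.left e))

/-- The categorical fiber product of totally epimorphic categories is totally epimorphic.
[cite: MochizukiFrdI2008, §0 p.17] -/
theorem isTotallyEpimorphic_cfp {C₁ C₂ E : Type*} [Category C₁] [Category C₂] [Category E]
    {Φ₁ : C₁ ⥤ E} {Φ₂ : C₂ ⥤ E} (h₁ : IsTotallyEpimorphic C₁) (h₂ : IsTotallyEpimorphic C₂) :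
    IsTotallyEpimorphic (CFP Φ₁ Φ₂) := by
  refine ⟨fun {X Y} f => ⟨fun {Z} g h e => ?_⟩⟩
  haveI := h₁.epi f.fst
  haveI := h₂.epi f.snd
  exact CFP.hom_ext ((cancel_epi f.fst).mp (congrArg CFP.Hom.fst e))
    ((cancel_epi f.snd).mp (congrArg CFP.Hom.snd e))

/-- `C₀ ×_{D₀} D`, `A`, `N`, `R` are totally epimorphic when `D` is (the total-epimorphicity half of
Ex. 3.3 (iv), without using RC-connectedness) — PROVED. [cite: MochizukiFrdII2008, Ex 3.3 (iv) p.29] -/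
theorem isTotallyEpimorphic_all (hD : IsTotallyEpimorphic D) :
    IsTotallyEpimorphic (C π) ∧ IsTotallyEpimorphic (A π) ∧ IsTotallyEpimorphic (N π) ∧
      IsTotallyEpimorphic (R π) := by
  have hC : IsTotallyEpimorphic (C π) :=
    PreFrobenioid.isTotallyEpimorphic_fiberProduct C0.isTotallyEpimorphic hD
  have hA : IsTotallyEpimorphic (A π) := isTotallyEpimorphic_wideSubcategory _ hC
  have hN : IsTotallyEpimorphic (N π) := isTotallyEpimorphic_wideSubcategory _ hA
  have hA0 : IsTotallyEpimorphic A0 := isTotallyEpimorphic_wideSubcategory _ C0.isTotallyEpimorphic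
  have hN0 : IsTotallyEpimorphic N0 := isTotallyEpimorphic_wideSubcategory _ hA0
  have hR0 : IsTotallyEpimorphic R0 := isTotallyEpimorphic_over hN0 _
  exact ⟨hC, hA, hN, isTotallyEpimorphic_cfp hR0 hD⟩

/-- **Ex. 3.3 (iv)**, total epimorphicity of `C`, `A`, `N`, `R` — PROVED. [cite: MochizukiFrdII2008, Ex 3.3 (iv) p.29] -/
theorem Ex33iv_totallyEpimorphic_holds : Ex33iv_totallyEpimorphic π :=
  fun hD _ => isTotallyEpimorphic_all π hD

/-! ### Example 3.3 (v), p. 29: slit morphisms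

The three FSMI statements carry the STANDING HYPOTHESIS of Example 3.3 (opening of (ii), p. 28: "Let
`D` be a connected, totally epimorphic category"), in force through (v): total epimorphicity of `D` is
what makes the `D`-components of a factorisation of a slit morphism invertible (irreducibility); it is
genuinely needed (for a base `D` containing a retract `r ∘ i = id`, `i ∘ r ≠ id`, the slit hull
`(incl, id)` factors as `(id, i) ≫ (incl, r)` with neither factor invertible). Fiberwise surjectivity,
monomorphy and non-invertibility of slit morphisms — hence the "not of FSM-type" statements — hold
for every base. -/

/-- **Ex. 3.3 (v)**, `F = A`: "any morphism of `F` that is obtained as the isotropic hull of an object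
of `F` whose angular region is determined by the complement in `S¹` of a single element of `S¹` is an
FSMI-morphism of `F` [cf. Lemma 3.2, (iii)]" — under the standing hypothesis "`D` … totally
epimorphic" of Ex. 3.3 (p. 28). [cite: MochizukiFrdII2008, Ex 3.3 (v) p.29] -/
def Ex33v_slit_isFSMI_A : Prop :=
  IsTotallyEpimorphic D → ∀ ⦃X Y : A π⦄ (φ : X ⟶ Y), A.IsSlitMorphism π φ → IsFSMI φ

/-- **Ex. 3.3 (v)**, `F = N`: slit morphisms of `N` are FSMI-morphisms of `N` (standing hypothesis
"`D` … totally epimorphic", p. 28). [cite: MochizukiFrdII2008, Ex 3.3 (v) p.29] -/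
def Ex33v_slit_isFSMI_N : Prop :=
  IsTotallyEpimorphic D → ∀ ⦃X Y : N π⦄ (φ : X ⟶ Y), N.IsSlitMorphism π φ → IsFSMI φ

/-- **Ex. 3.3 (v)**, `F = R`: slit morphisms of `R` are FSMI-morphisms of `R` (standing hypothesis
"`D` … totally epimorphic", p. 28). [cite: MochizukiFrdII2008, Ex 3.3 (v) p.29] -/
def Ex33v_slit_isFSMI_R : Prop :=
  IsTotallyEpimorphic D → ∀ ⦃X Y : R π⦄ (φ : X ⟶ Y), R.IsSlitMorphism π φ → IsFSMI φ

/-- **Ex. 3.3 (v)**, `F = A`: "the existence of slit morphisms implies that `F` is not of FSM-type".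
[cite: MochizukiFrdII2008, Ex 3.3 (v) p.29] -/
def Ex33v_not_FSMType_A : Prop :=
  (∃ (X Y : A π) (φ : X ⟶ Y), A.IsSlitMorphism π φ) → ¬ IsOfFSMType (A π)

/-- **Ex. 3.3 (v)**, `F = N`: the existence of slit morphisms implies that `N` is not of FSM-type.
[cite: MochizukiFrdII2008, Ex 3.3 (v) p.29] -/
def Ex33v_not_FSMType_N : Prop :=
  (∃ (X Y : N π) (φ : X ⟶ Y), N.IsSlitMorphism π φ) → ¬ IsOfFSMType (N π)

/-- **Ex. 3.3 (v)**, `F = R`: the existence of slit morphisms implies that `R` is not of FSM-type.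
[cite: MochizukiFrdII2008, Ex 3.3 (v) p.29] -/
def Ex33v_not_FSMType_R : Prop :=
  (∃ (X Y : R π) (φ : X ⟶ Y), R.IsSlitMorphism π φ) → ¬ IsOfFSMType (R π)

/-! ### Remark 3.3.1, p. 29 -/

/-- The map on angular data underlying the isomorphism (c) of an arrow of `C₀`: `a ↦ c · a^{deg_Fr}`
(Rmk. 3.3.1: "induces an injection on underlying angular regions").
[cite: MochizukiFrdII2008, Rmk 3.3.1 p.29] -/
def C0.regionMap {X Y : C0} (φ : X ⟶ Y) (a : ℂˣ) : ℂˣ := C0.scalar φ * a ^ (C0.degFr φ : ℕ)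

/-- **Remark 3.3.1**, `C`: "in any of the categories `C`, `A`, `N`, or `R`, a base-isomorphism between
complex objects is a monomorphism if and only if it induces an injection on underlying angular regions."
[cite: MochizukiFrdII2008, Rmk 3.3.1 p.29] -/
def Rmk331_C : Prop :=
  ∀ ⦃X Y : C π⦄ (φ : X ⟶ Y), X.fst.IsComplexObj → Y.fst.IsComplexObj →
    PreFrobenioid.IsBaseIso (C.toElem π) φ →
      (Mono φ ↔ Set.InjOn (C0.regionMap φ.fst) X.fst.region.carrier)

/-- **Remark 3.3.1**, `A`. [cite: MochizukiFrdII2008, Rmk 3.3.1 p.29] -/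
def Rmk331_A : Prop :=
  ∀ ⦃X Y : A π⦄ (φ : X ⟶ Y), X.obj.fst.IsComplexObj → Y.obj.fst.IsComplexObj →
    PreFrobenioid.IsBaseIso (A.toElem π) φ →
      (Mono φ ↔ Set.InjOn (C0.regionMap φ.1.fst) X.obj.fst.region.carrier)

/-- **Remark 3.3.1**, `N` (base-isomorphism read in `C`). [cite: MochizukiFrdII2008, Rmk 3.3.1 p.29] -/
def Rmk331_N : Prop :=
  ∀ ⦃X Y : N π⦄ (φ : X ⟶ Y), X.obj.obj.fst.IsComplexObj → Y.obj.obj.fst.IsComplexObj →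
    PreFrobenioid.IsBaseIso (C.toElem π) ((N.toC π).map φ) →
      (Mono φ ↔ Set.InjOn (C0.regionMap ((N.toC π).map φ).fst) X.obj.obj.fst.region.carrier)

/-- **Remark 3.3.1**, `R` (base-isomorphism and angular data read in `C` via `R.toC`).
[cite: MochizukiFrdII2008, Rmk 3.3.1 p.29] -/
def Rmk331_R : Prop :=
  ∀ ⦃X Y : R π⦄ (φ : X ⟶ Y), ((R.toC π).obj X).fst.IsComplexObj → ((R.toC π).obj Y).fst.IsComplexObj →
    PreFrobenioid.IsBaseIso (C.toElem π) ((R.toC π).map φ) →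
      (Mono φ ↔ Set.InjOn (C0.regionMap ((R.toC π).map φ).fst) ((R.toC π).obj X).fst.region.carrier)

end ArchFrd

end

end Literature.AlgebraicGeometry.Frobenioids
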